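import Summits.QuantumFields.YangMills.Theorems.LangevinControlUVOSLegsFromFemtoAndGapDefs
import Summits.QuantumFields.YangMills.Theorems.LangevinControlUVOSLegsFromFemtoAndGapStubPinAux

/-!
# Crux `OSLegsFromFemtoAndGap` (stmt-QuantumFields-9367), line `dlr-collar-transfer`: repaired `stub_pin`

The registered stub `stub_pin : Statement.stub_pin` of the skeleton
`Cruxes/OSLegsFromFemtoAndGap/Lines/dlr_collar_transfer.lean` (H1 `TwoPoint` ∧ H3 `GapInUnits` ⇒ `TwoPointPinned`
for an ARBITRARY unit map `a`) is the crux's own typing residue X1 (Disproof §6/§8: fast-decaying step unit maps with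
pairwise incommensurable plateaux; formally undecidable today, Disproof §1).  This file lands the REPAIRED statement
under the tenure repair R1′ (`Continuous a`): `twoPointPinned_of_continuous : Continuous a → TwoPoint G r a →
TwoPointPinned G r a` (H3 is not needed), by the interval-pinning argument of the aux file
`LangevinControlUVOSLegsFromFemtoAndGapStubPinAux.lean` (`pinning_of_femtoBox`: maximum of `a`, `N = ⌈s₂/M⌉`,
intermediate value theorem, compactness, continuity of `β ↦ wilsonExpectation`).  Once the crux is restated with
`Continuous a`, the stub closes by `exact twoPointPinned_of_continuous G r a ha h₁`.
-/

set_option autoImplicit false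

noncomputable section

open MeasureTheory Filter Topology
open Literature.MathematicalPhysics.QuantumFieldTheory Literature.MathematicalPhysics.QuantumLattice
open Summit.QuantumFields.YangMills.Theorems.OSLegsFromFemtoAndGap (pinning_of_femtoBox)
open Summit.QuantumFields.YangMills.Cruxes.OSLegsFromFemtoAndGap.DlrCollarTransfer (TwoPoint GapInUnits TwoPointPinned)

namespace Summit.QuantumFields.YangMills.Cruxes.OSLegsFromFemtoAndGap.DlrCollarTransfer

/-- **Repaired `stub_pin` (tenure repair R1′: continuous unit map).**  For every compact `G`, faithful unitary
lattice representation `r` and CONTINUOUS unit map `a`, the femto two-point package H1 (`TwoPoint G r a`) already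
carries an interval-pinned shape function: `TwoPointPinned G r a` holds with the SAME witnesses `Γ, β₀, ℓ₀, c, C`,
the extra clause (`Γ ≥ m > 0` on every `[s₁, s₂]`, `0 < s₁`, `8 s₂ ≤ ℓ₀`) being `pinning_of_femtoBox`
(maximum of `a` on `[β₀, ∞)`, `N = ⌈s₂ / max a⌉`, intermediate value theorem on `β ↦ N a(β)`, minimum of the
continuous axis covariance `β ↦ N⁸ Cov_{β, 8N}(P_0, P_{N e₂})` on a compact set of couplings).  The typed stub
`stub_pin` (arbitrary `a`, plus the unused H3) is the crux residue X1 and is NOT claimed here. -/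
theorem twoPointPinned_of_continuous (G : Type) [Group G] [TopologicalSpace G] [IsTopologicalGroup G]
    [CompactSpace G] [MeasurableSpace G] [BorelSpace G] (r : LatticeRep G) (a : ℝ → ℝ)
    (ha : Continuous a) (h : TwoPoint G r a) : TwoPointPinned G r a := by
  obtain ⟨Γ, β₀, ℓ₀, c, C, hℓ₀, hc, hpos, hlim, hΓ, hbox⟩ := h
  exact ⟨Γ, β₀, ℓ₀, c, C, hℓ₀, hc, hpos, hlim, hΓ,
    fun s₁ s₂ hs₁ hs₁₂ hs₂ => pinning_of_femtoBox r ha hc hpos hlim hΓ hbox s₁ s₂ hs₁ hs₁₂ hs₂, hbox⟩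

/-- **The repaired stub, closed form (registered sub-goal `stubPin_of_continuous`).**  VERBATIM `Statement.stub_pin`
with the single tenure repair R1′ inserted (`Continuous a →`): for every compact simple `G`, faithful unitary `r` and
continuous unit map `a`, H1 ∧ H3 ⇒ H1 pinned.  (Simplicity of `G` and H3 `GapInUnits` are carried only to make this a
drop-in for the restated stub; the content is `twoPointPinned_of_continuous`, which uses neither.) -/
theorem stubPin_of_continuous : ∀ (G : Type) [Group G] [TopologicalSpace G] [IsTopologicalGroup G] [CompactSpace G] [MeasurableSpace G] [BorelSpace G], IsCompactSimpleLieGroup G → ∀ (r : LatticeRep G) (a : ℝ → ℝ), Continuous a → TwoPoint G r a → GapInUnits G r a → TwoPointPinned G r a :=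
  fun G _ _ _ _ _ _ _ r a ha h _ => twoPointPinned_of_continuous G r a ha h

end Summit.QuantumFields.YangMills.Cruxes.OSLegsFromFemtoAndGap.DlrCollarTransfer

end
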